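import Summits.RiemannHypothesis.RiemannHypothesis.Theorems.WeilFormatCPolyWindowIncrement
import Summits.RiemannHypothesis.RiemannHypothesis.Theorems.WeilFormatCPolyWindowPole
import Summits.RiemannHypothesis.RiemannHypothesis.Theorems.WeilFormatCEntryArch
import HarnessLib

/-!
# Format C, design C∞ (L2–III): the archimedean block of indicator and monomial windows; the window constants

Route context: Fourier–Galerkin / Schur-complement certificates of Weil positivity on a window ("format C";
cell memo `run/shared/lean/pub/rh-explicit/rh-explicit-weil-10/FORMATC-DESIGN.md` §1.5, §9.12.7–§9.12.11; supporting
stmt-RiemannHypothesis-0098; seat rh-explicit-weil-10).  Third file of the monomial-window chain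
(`WeilFormatCPolyWindowIncrement.lean`: increments / prime block; `WeilFormatCPolyWindowPole.lean`: pole form).  Here: the
archimedean energy `∫₀^∞ ρ(t) D_t(u, v) dt`, `ρ(t) = e^{t/2}/(2 sinh t) = weilArchDensity t`, of the sesquilinear window form
(`WeilFormatCDefs.weilWindowSesq`), the analogue of `WeilFormatCEntryArch.lean` / `…ArchSeries.lean` for polynomial windows.

* `weilIncrementSesq_of_lt` — beyond the window scale (`t > 2a`) the pairing of two window functions is the constant
  `2∫ u conj v` (the shifted overlaps vanish);
* `setIntegral_weilArchDensity_mul_weilIncrementSesq_split` — for window functions (`a > 0`):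
  `∫_{(0,∞)} ρ D_t(u,v) = ∫_{(0,2a]} ρ D_t(u,v) + 2(∫ u conj v)·∫_{(2a,∞)} ρ`;
* monomial windows `1x^j = x^j·1_{[−a,a]}`: on `(0, 2a]` the pairing is the real polynomial `K_{jk}(t)` of
  `weilIncrementSesq_indicator_pow`, so the archimedean block is the REAL number
  `∫_{(0,2a]} ρ(t) K_{jk}(t) dt + 2 m_{j+k} ∫_{(2a,∞)} ρ`, `m_n = (a^{n+1} − (−a)^{n+1})/(n+1)`
  (`setIntegral_weilArchDensity_mul_weilIncrementSesq_indicator_pow`);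
* the WINDOW CONSTANTS `W_p(a) = ∫_{(0,2a]} ρ(t) t^{p} dt` (`p ≥ 1`) and the tail `∫_{(2a,∞)} ρ`: integrability, the absolutely
  convergent expansions over the nodes `l_k = 2k + ½` (`ρ = Σ_k e^{−l_k t}`):
  `W_{p}(a) = Σ_k ∫_0^{2a} t^{p} e^{−l_k t} dt`, each term in closed form
  `p!/l^{p+1} − e^{−2al} Σ_{m≤p} p^{(m)} (2a)^{p−m}/l^{m+1}` (`setIntegral_exp_neg_mul_pow_eq`), and
  `∫_{(2a,∞)} ρ = Σ_k e^{−2a l_k}/l_k`; and the linearity lemma that evaluates `∫_{(0,2a]} ρ(t)·(Σ_p d_p t^{p+1}) dt` as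
  `Σ_p d_p W_{p+1}(a)` — the form in which the (E) side encloses the archimedean block of polynomial windows
  (Hurwitz-`ζ(p+1, ¼)` constants minus incomplete-Gamma corrections, FORMATC-DESIGN §1.5).

Pure calculus; standard axioms; no RH claim.
-/

set_option autoImplicit false
-- `Summit.RiemannHypothesis.RiemannHypothesis.…` is the layout-mandated namespace (summit = problem name).
set_option linter.dupNamespace false

noncomputable section

open Complex Filter Set MeasureTheory
open scoped Real Topology ComplexConjugate

namespace Summit.RiemannHypothesis.RiemannHypothesis.Theorems.WeilFormatC

open Literature.NumberTheory.LFunctions Literature.Analysis.SpecialFunctions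

variable {a : ℝ} {u v : ℝ → ℂ}

/-! ## Beyond the window scale the pairing is constant -/

/-- For window functions `u, v` on `[−a, a]` and `t > 2a` the shifted overlap `∫ u(x+t) conj v(x) dx` vanishes. -/
theorem integral_shift_mul_conj_of_lt (hu : IsWindowFunction a u) (hv : IsWindowFunction a v) {t : ℝ}
    (ht : 2 * a < t) : ∫ x, u (x + t) * conj (v x) = 0 := by
  have h : (fun x ↦ u (x + t) * conj (v x)) = fun _ ↦ (0 : ℂ) := by
    funext x
    by_cases hx : x ∈ Icc (-a) a
    · have hxt : x + t ∉ Icc (-a) a := fun h ↦ by linarith [hx.1, h.2]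
      rw [hu.eq_zero _ hxt, zero_mul]
    · rw [hv.eq_zero x hx, map_zero, mul_zero]
  rw [h, integral_zero]

/-- **Beyond the window scale** (`t > 2a`): `D_t(u, v) = 2 ∫ u conj v` for window functions `u, v`. -/
theorem weilIncrementSesq_of_lt (hu : IsWindowFunction a u) (hv : IsWindowFunction a v) {t : ℝ} (ht : 2 * a < t) :
    weilIncrementSesq u v t = 2 * ∫ x, u x * conj (v x) := by
  rw [weilIncrementSesq_eq_overlap hu hv, integral_shift_mul_conj_of_lt hu hv ht,
    integral_shift_mul_conj_of_lt hv hu ht, map_zero, sub_zero, sub_zero]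

/-- **Splitting the archimedean energy at the window scale.**  For window functions `u, v` on `[−a, a]` (`a > 0`):
`∫_{(0,∞)} ρ(t) D_t(u,v) dt = ∫_{(0,2a]} ρ(t) D_t(u,v) dt + 2(∫ u conj v) · ∫_{(2a,∞)} ρ(t) dt`. -/
theorem setIntegral_weilArchDensity_mul_weilIncrementSesq_split (ha : 0 < a) (hu : IsWindowFunction a u)
    (hv : IsWindowFunction a v) :
    ∫ t in Ioi 0, (weilArchDensity t : ℂ) * weilIncrementSesq u v t =
      (∫ t in Ioc 0 (2 * a), (weilArchDensity t : ℂ) * weilIncrementSesq u v t) +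
        (2 * ∫ x, u x * conj (v x)) * ((∫ t in Ioi (2 * a), weilArchDensity t : ℝ) : ℂ) := by
  have hT : (0 : ℝ) ≤ 2 * a := by positivity
  have hint := integrableOn_weilArchDensity_mul_weilIncrementSesq ha.le hu hv
  rw [← Ioc_union_Ioi_eq_Ioi hT, setIntegral_union Ioc_disjoint_Ioi_same measurableSet_Ioi
    (hint.mono_set Ioc_subset_Ioi_self) (hint.mono_set (Ioi_subset_Ioi hT))]
  congr 1
  have hIoi : EqOn (fun t ↦ (weilArchDensity t : ℂ) * weilIncrementSesq u v t)
      (fun t ↦ (weilArchDensity t : ℂ) * (2 * ∫ x, u x * conj (v x))) (Ioi (2 * a)) := fun t ht ↦ by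
    simp only [weilIncrementSesq_of_lt hu hv (mem_Ioi.1 ht)]
  rw [setIntegral_congr_fun measurableSet_Ioi hIoi, MeasureTheory.integral_mul_const, integral_complex_ofReal]
  ring

/-! ## The archimedean block of two monomial windows -/

/-- On the window scale the archimedean integrand of two monomial windows is real:
`∫_{(0,2a]} ρ(t) D_t(1x^j, 1x^k) dt = ∫_{(0,2a]} ρ(t) K_{jk}(t) dt` with the polynomial `K_{jk}` of
`weilIncrementSesq_indicator_pow`. -/
theorem setIntegral_Ioc_weilArchDensity_mul_weilIncrementSesq_indicator_pow (j k : ℕ) :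
    ∫ t in Ioc 0 (2 * a), (weilArchDensity t : ℂ) *
        weilIncrementSesq ((Icc (-a) a).indicator fun x : ℝ ↦ ((x : ℂ)) ^ j)
          ((Icc (-a) a).indicator fun x : ℝ ↦ ((x : ℂ)) ^ k) t =
      ((∫ t in Ioc 0 (2 * a), weilArchDensity t *
        (2 * ((a ^ (j + k + 1) - (-a) ^ (j + k + 1)) / (j + k + 1))
          - (∑ i ∈ Finset.range (j + 1), (j.choose i : ℝ) * t ^ (j - i) *
              (((a - t) ^ (i + k + 1) - (-a) ^ (i + k + 1)) / (i + k + 1)))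
          - (∑ i ∈ Finset.range (k + 1), (k.choose i : ℝ) * t ^ (k - i) *
              (((a - t) ^ (i + j + 1) - (-a) ^ (i + j + 1)) / (i + j + 1)))) : ℝ) : ℂ) := by
  rw [← integral_complex_ofReal]
  refine setIntegral_congr_fun measurableSet_Ioc fun t ht ↦ ?_
  rw [weilIncrementSesq_indicator_pow j k ht.1.le ht.2]
  push_cast
  ring

/-- **The archimedean block of two monomial windows** (`a > 0`), a REAL number:
`∫_{(0,∞)} ρ(t) D_t(1x^j, 1x^k) dt = ∫_{(0,2a]} ρ(t) K_{jk}(t) dt + 2 m_{j+k} ∫_{(2a,∞)} ρ(t) dt`,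
`m_{j+k} = (a^{j+k+1} − (−a)^{j+k+1})/(j+k+1)`, `K_{jk}` the window-scale polynomial of `weilIncrementSesq_indicator_pow`. -/
theorem setIntegral_weilArchDensity_mul_weilIncrementSesq_indicator_pow (ha : 0 < a) (j k : ℕ) :
    ∫ t in Ioi 0, (weilArchDensity t : ℂ) *
        weilIncrementSesq ((Icc (-a) a).indicator fun x : ℝ ↦ ((x : ℂ)) ^ j)
          ((Icc (-a) a).indicator fun x : ℝ ↦ ((x : ℂ)) ^ k) t =
      (((∫ t in Ioc 0 (2 * a), weilArchDensity t *
          (2 * ((a ^ (j + k + 1) - (-a) ^ (j + k + 1)) / (j + k + 1))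
            - (∑ i ∈ Finset.range (j + 1), (j.choose i : ℝ) * t ^ (j - i) *
                (((a - t) ^ (i + k + 1) - (-a) ^ (i + k + 1)) / (i + k + 1)))
            - (∑ i ∈ Finset.range (k + 1), (k.choose i : ℝ) * t ^ (k - i) *
                (((a - t) ^ (i + j + 1) - (-a) ^ (i + j + 1)) / (i + j + 1)))))
        + 2 * ((a ^ (j + k + 1) - (-a) ^ (j + k + 1)) / (j + k + 1)) *
            ∫ t in Ioi (2 * a), weilArchDensity t : ℝ) : ℂ) := by
  rw [setIntegral_weilArchDensity_mul_weilIncrementSesq_split ha (isWindowFunction_indicator_pow a j)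
      (isWindowFunction_indicator_pow a k),
    setIntegral_Ioc_weilArchDensity_mul_weilIncrementSesq_indicator_pow,
    integral_indicator_pow_mul_conj_indicator_pow ha.le]
  push_cast
  ring

/-! ## The window constants `W_p(a) = ∫_{(0,2a]} ρ(t) t^p dt` and the tail `∫_{(2a,∞)} ρ` -/

/-- `|t^{p+1}| ≤ (2a)^p · t` on `(0, 2a]`. -/
theorem abs_pow_succ_le_window {t : ℝ} (p : ℕ) (ht : t ∈ Ioc 0 (2 * a)) :
    |t ^ (p + 1)| ≤ (2 * a) ^ p * t := by
  rw [abs_of_nonneg (pow_nonneg ht.1.le _), pow_succ]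
  exact mul_le_mul_of_nonneg_right (pow_le_pow_left₀ ht.1.le ht.2 p) ht.1.le

/-- `ρ(t) t^{p+1}` is integrable on `(0, 2a]` (`a > 0`). -/
theorem integrableOn_weilArchDensity_mul_pow_succ (ha : 0 < a) (p : ℕ) :
    IntegrableOn (fun t ↦ weilArchDensity t * t ^ (p + 1)) (Ioc 0 (2 * a)) :=
  integrableOn_weilArchDensity_mul (by positivity) (by fun_prop : Continuous fun t : ℝ ↦ t ^ (p + 1)).continuousOn
    (C := (2 * a) ^ p) fun _ ht ↦ abs_pow_succ_le_window p ht

/-- **The window constants as node series**: `Σ_k ∫_{(0,2a]} e^{−l_k t} t^{p+1} dt = ∫_{(0,2a]} ρ(t) t^{p+1} dt`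
(`l_k = 2k + ½ = digammaNode k`, absolutely convergent; `a > 0`). -/
theorem hasSum_setIntegral_weilArchDensity_mul_pow_succ (ha : 0 < a) (p : ℕ) :
    HasSum (fun k : ℕ ↦ ∫ t in Ioc 0 (2 * a), Real.exp (-(digammaNode k * t)) * t ^ (p + 1))
      (∫ t in Ioc 0 (2 * a), weilArchDensity t * t ^ (p + 1)) :=
  hasSum_setIntegral_exp_mul (by positivity) (by fun_prop : Continuous fun t : ℝ ↦ t ^ (p + 1)).continuousOn
    (C := (2 * a) ^ p) fun _ ht ↦ abs_pow_succ_le_window p ht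

/-- The node integrals in raw closed form: `∫_{(0,T]} e^{−lt} t^p dt` by `integral_pow_mul_exp_eq_sum` with `c = −l` (`l ≠ 0`, `T ≥ 0`). -/
theorem setIntegral_exp_neg_mul_pow_eq_sum {l T : ℝ} (hl : l ≠ 0) (hT : 0 ≤ T) (p : ℕ) :
    ∫ t in Ioc 0 T, Real.exp (-(l * t)) * t ^ p =
      ∑ k ∈ Finset.range (p + 1), (-1) ^ k * (p.descFactorial k : ℝ) *
        (T ^ (p - k) * Real.exp (-l * T) - 0 ^ (p - k) * Real.exp (-l * 0)) / (-l) ^ (k + 1) := by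
  rw [← intervalIntegral.integral_of_le hT, ← integral_pow_mul_exp_eq_sum (neg_ne_zero.2 hl) p 0 T]
  refine intervalIntegral.integral_congr fun t _ ↦ ?_
  simp only [neg_mul]
  ring

/-- **The node integrals in closed form** (`l ≠ 0`, `T ≥ 0`):
`∫_{(0,T]} e^{−lt} t^p dt = p!/l^{p+1} − e^{−lT} Σ_{m=0}^{p} p^{(m)} T^{p−m}/l^{m+1}`
(for the window `T = 2a`: the Hurwitz-zeta main term and the incomplete-Gamma correction of FORMATC-DESIGN §1.5). -/
theorem setIntegral_exp_neg_mul_pow_eq {l T : ℝ} (hl : l ≠ 0) (hT : 0 ≤ T) (p : ℕ) :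
    ∫ t in Ioc 0 T, Real.exp (-(l * t)) * t ^ p =
      (p.factorial : ℝ) / l ^ (p + 1) -
        Real.exp (-(l * T)) * ∑ m ∈ Finset.range (p + 1), (p.descFactorial m : ℝ) * T ^ (p - m) / l ^ (m + 1) := by
  rw [setIntegral_exp_neg_mul_pow_eq_sum hl hT]
  -- per-term: `(−1)^k/(−l)^{k+1} = −1/l^{k+1}`
  have hterm : ∀ k : ℕ, (-1 : ℝ) ^ k * (p.descFactorial k : ℝ) *
      (T ^ (p - k) * Real.exp (-l * T) - 0 ^ (p - k) * Real.exp (-l * 0)) / (-l) ^ (k + 1) =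
      -((p.descFactorial k : ℝ) * (T ^ (p - k) * Real.exp (-(l * T)) - 0 ^ (p - k)) / l ^ (k + 1)) := by
    intro k
    have h1 : ((-1 : ℝ) ^ k) ≠ 0 := pow_ne_zero _ (by norm_num)
    rw [mul_zero, Real.exp_zero, mul_one, neg_mul, neg_pow l (k + 1), pow_succ (-1 : ℝ) k, mul_assoc ((-1 : ℝ) ^ k),
      mul_assoc ((-1 : ℝ) ^ k), mul_div_mul_left _ _ h1, neg_one_mul, div_neg]
  -- the `0`-terms: only `k = p` survives
  have hzero : ∑ k ∈ Finset.range (p + 1), (p.descFactorial k : ℝ) * 0 ^ (p - k) / l ^ (k + 1) =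
      (p.factorial : ℝ) / l ^ (p + 1) := by
    rw [Finset.sum_eq_single p]
    · rw [Nat.sub_self, pow_zero, mul_one, Nat.descFactorial_self]
    · intro k hk hkp
      have hlt : k < p := lt_of_le_of_ne (Nat.lt_succ_iff.1 (Finset.mem_range.1 hk)) hkp
      rw [zero_pow (Nat.sub_ne_zero_of_lt hlt), mul_zero, zero_div]
    · intro h
      exact absurd (Finset.mem_range.2 (Nat.lt_succ_self p)) h
  rw [Finset.sum_congr rfl fun k _ ↦ hterm k, ← hzero, Finset.mul_sum, ← Finset.sum_sub_distrib]
  exact Finset.sum_congr rfl fun k _ ↦ by ring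

/-- **The tail of the archimedean density as a node series**: `Σ_k e^{−2a l_k}/l_k = ∫_{(2a,∞)} ρ(t) dt` (`a > 0`). -/
theorem hasSum_setIntegral_Ioi_weilArchDensity (ha : 0 < a) :
    HasSum (fun k : ℕ ↦ Real.exp (-(digammaNode k * (2 * a))) / digammaNode k)
      (∫ t in Ioi (2 * a), weilArchDensity t) := by
  have h := hasSum_setIntegral_Ioi_exp (T := 2 * a) (by positivity)
  refine h.congr_fun fun k ↦ ?_
  exact (Literature.NumberTheory.LFunctions.SchmidtTauberian.integral_exp_neg_Ioi' (digammaNode_pos k) (2 * a)).symm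

/-! ## Linearity: the archimedean block of a polynomial kernel through the window constants -/

/-- **Evaluating a polynomial kernel against the density.**  For coefficients `d_p` (`p < n`) and `a > 0`:
`∫_{(0,2a]} ρ(t)·(Σ_{p<n} d_p t^{p+1}) dt = Σ_{p<n} d_p · ∫_{(0,2a]} ρ(t) t^{p+1} dt` — every window-scale increment
polynomial `K(t)` (zero constant term) of two polynomial windows is of this shape, so its archimedean block is a finite
combination of the window constants `W_{p+1}(a)`. -/
theorem setIntegral_weilArchDensity_mul_sum_pow_succ (ha : 0 < a) (n : ℕ) (d : ℕ → ℝ) :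
    ∫ t in Ioc 0 (2 * a), weilArchDensity t * ∑ p ∈ Finset.range n, d p * t ^ (p + 1) =
      ∑ p ∈ Finset.range n, d p * ∫ t in Ioc 0 (2 * a), weilArchDensity t * t ^ (p + 1) := by
  have hI : ∀ p ∈ Finset.range n,
      IntegrableOn (fun t ↦ d p * (weilArchDensity t * t ^ (p + 1))) (Ioc 0 (2 * a)) :=
    fun p _ ↦ (integrableOn_weilArchDensity_mul_pow_succ ha p).const_mul (d p)
  have hpt : ∀ t : ℝ, weilArchDensity t * ∑ p ∈ Finset.range n, d p * t ^ (p + 1) =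
      ∑ p ∈ Finset.range n, d p * (weilArchDensity t * t ^ (p + 1)) := by
    intro t
    rw [Finset.mul_sum]
    exact Finset.sum_congr rfl fun p _ ↦ by ring
  simp_rw [hpt]
  rw [integral_finsetSum _ hI]
  exact Finset.sum_congr rfl fun p _ ↦ MeasureTheory.integral_const_mul _ _

end Summit.RiemannHypothesis.RiemannHypothesis.Theorems.WeilFormatC

end
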